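import Literature.AnabelianGeometry.SemiGraphs.TemperedCompactCentralizerInVerticial
import Literature.AnabelianGeometry.SemiGraphs.TemperedCompactInVerticialAtOfNoEscape
import Literature.AnabelianGeometry.SemiGraphs.TemperedCompactFixedSystemsBaire
import HarnessLib

/-!
# [SemiAnbd] Thm 3.7 (iii) / Cor 3.9 (R3c) at an ARBITRARY countable `𝒢`: a centralising element lies in
# the verticial host unless it ESCAPES along the host's vertex system (proof-only)

Mochizuki, *Semi-graphs of anabelioids*, Publ. RIMS **42** (2006), §3, Theorem 3.7 (iii) pp. 40–41
("if `H` fixes two vertices of `𝒢_{∞,j}`, then these two vertices are joined to one another by a single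
edge") and Corollary 3.9, proof p. 43 l. 13 ("[again by Theorem 3.7, (iii), (iv)]"; the cell's step (R3c),
FACT-LIST rows F-2772 `EdgeLikeCentralizerAt` / F-2773 `EdgeLikeCentralizer`)
[cite: MochizukiSemiAnbd2006, Cor 3.9 p.43].

PROOF-ONLY sequel of `TemperedCompactCentralizerInVerticial.lean` (abc-iut cell, block F, seat abc-iut-f-172
gen 4; no definition, no new named fact).  There, the centraliser of a nontrivial compact `C` was placed in
every verticial host `H ⊇ C` from the adjacency clause `hadj` of (FIX∞), available at LOCALLY FINITE `𝔾`.  The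
argument in fact consumes `hadj` for two pairs only — `(y, g·y)` and `(y, g²·y)`, `y` a vertex system of `H`
— and not even the fixedness of the joining edges.  Combined with abc-iut-L3-t10's HYPOTHESIS-FREE
`hadj_temperedPiChart_of_bounded_dist'` (two compatible systems fixed by a compact `C ≠ 1` that stay at
BOUNDED subdivision distance are adjacent where they differ — every countable `𝒢` satisfying the hypotheses
of Thm 3.7, no finiteness) and the isometry of the action (`SemiGraph.subdivision_dist_nodeMap`), this gives,
at EVERY countable `𝒢`:

* `VerticialLevelData.mem_of_adjacent_translates` — over any level data: if `y` is a compatible vertex system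
  fixed by the verticial `H` and the translates `g·yⱼ`, `g²·yⱼ` are, at every level, equal or adjacent to
  `yⱼ`, then `g ∈ H` (one-level tree argument of the prequel, hypotheses pared down to adjacency).
* `mem_verticial_of_centralizer_of_bounded_displacement` — **ESCAPE DICHOTOMY** at the canonical tower
  (`verticialLevelData_temperedPiChart`): for `C` compact `≠ 1`, `H ⊇ C` verticial, `y` a compatible
  `H`-fixed vertex system of the trees `𝔾̃ₙ`, and `g` centralising `C`: if the displacement
  `dist(yⱼ, g·yⱼ)` is BOUNDED in `j`, then `g ∈ H`; `centralizer_dichotomy` — either `g ∈ H`, or `g` ESCAPES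
  along `y` (unbounded displacement).  No finiteness, no (FIX∞), neither sentence of Thm 3.7 (iii).
* `edgeLikeCentralizer_of_bounded_displacement` — the frozen ∀-fact F-2773 re-bound to «no element
  centralising an open edge piece `ψ(U)` escapes along the system of a verticial host» (strictly weaker than
  the (FIX∞).hadj binder of `edgeLikeCentralizer_of_hadj`; a theorem at locally finite `𝔾` by the prequel,
  open at vertices of infinite valence — the cell's residual G-t6g3-2b).

Honest framing: the bare ∀-countable closure of F-2773 is NOT claimed; nothing here bears on [IUTchIII]
Cor. 3.12; typed ≠ proved elsewhere.
-/

namespace Literature.AnabelianGeometry.SemiGraphs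

namespace ProfiniteSemiGraph

open CategoryTheory Topology

universe v u

namespace VerticialLevelData

variable {𝒢 : ProfiniteSemiGraph.{u}} {c : TemperedPiChart 𝒢} (D : VerticialLevelData.{v} 𝒢 c)

/-! ### Bookkeeping for the action through `Aut (tree j)` -/

/-- The action of a product on a vertex of `𝒢_{∞,j}`. [cite: MochizukiSemiAnbd2006, Thm 3.7(iii) p.41] -/
private theorem act_mul_vertexMap' (j : D.J) (a b : c.G) (y : (D.tree j).Vertex) :
    (D.act j (a * b)).hom.vertexMap y = (D.act j a).hom.vertexMap ((D.act j b).hom.vertexMap y) := by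
  rw [map_mul]; rfl

/-- The action of `1` on a vertex of `𝒢_{∞,j}`. [cite: MochizukiSemiAnbd2006, Thm 3.7(iii) p.41] -/
private theorem act_one_vertexMap' (j : D.J) (y : (D.tree j).Vertex) : (D.act j 1).hom.vertexMap y = y := by
  rw [map_one]; rfl

/-- Each `g` acts injectively on the vertices of `𝒢_{∞,j}`. [cite: MochizukiSemiAnbd2006, Thm 3.7(iii) p.41] -/
private theorem act_vertexMap_injective' (j : D.J) (g : c.G) :
    Function.Injective (D.act j g).hom.vertexMap := by
  intro y₁ y₂ h
  have h' := congrArg (D.act j g⁻¹).hom.vertexMap h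
  rwa [← D.act_mul_vertexMap', ← D.act_mul_vertexMap', inv_mul_cancel, D.act_one_vertexMap',
    D.act_one_vertexMap'] at h'

/-- The translate `g·x` of a compatible vertex system is compatible (equivariance of the transition maps).
[cite: MochizukiSemiAnbd2006, Thm 3.7(iii) p.41] -/
theorem translate_compat' (g : c.G) {x : ∀ j, (D.tree j).Vertex}
    (hx : ∀ ⦃i j : D.J⦄ (h : i ≤ j), (D.trans h).vertexMap (x j) = x i) :
    ∀ ⦃i j : D.J⦄ (h : i ≤ j),
      (D.trans h).vertexMap ((D.act j g).hom.vertexMap (x j)) = (D.act i g).hom.vertexMap (x i) := by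
  intro i j h
  rw [D.trans_act_vertexMap, hx h]

/-- If `g` commutes with `C`, the translate `g·x` of a `C`-fixed vertex system is `C`-fixed.
[cite: MochizukiSemiAnbd2006, Thm 3.7(iii) p.41] -/
theorem translate_fixed' {C : Subgroup c.G} {g : c.G} (hcomm : ∀ k ∈ C, k * g = g * k)
    {x : ∀ j, (D.tree j).Vertex} (hx : ∀ k ∈ C, ∀ j, (D.act j k).hom.vertexMap (x j) = x j) :
    ∀ k ∈ C, ∀ j, (D.act j k).hom.vertexMap ((D.act j g).hom.vertexMap (x j)) =
      (D.act j g).hom.vertexMap (x j) := by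
  intro k hk j
  rw [← D.act_mul_vertexMap', hcomm k hk, D.act_mul_vertexMap', hx k hk j]

/-! ### `g ∈ H` as soon as `g·y` and `g²·y` stay adjacent to the system `y` of `H` -/

/-- **An element whose first two translates of the vertex system of a verticial subgroup stay adjacent to it
lies in that verticial subgroup** ([SemiAnbd] Thm 3.7 (iii) p. 41, Cor. 3.9 p. 43 l. 13): over the level data
`D` of a chart, let `y` be a compatible vertex system fixed by the verticial subgroup `H` and `g ∈ π₁^temp(𝒢)`
such that, at every level `j`, `g·yⱼ` is `yⱼ` or joined to it by an edge, and likewise `g²·yⱼ`.  Then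
`g ∈ H`.  (If `g·yᵢ ≠ yᵢ`: the edge `ε : yᵢ — g·yᵢ` has the translate `g·ε : g·yᵢ — g²·yᵢ`; `g·ε = ε` would
make `g` fix `yᵢ`, the action being over `𝔾`; otherwise `g²·yᵢ = yᵢ` gives a double edge and
`g²·yᵢ — yᵢ` a triangle in the tree `𝒢_{∞,i}`; so `g` fixes `y`, whose stabiliser is `H` by (I2) and
Thm 3.7 (ii).) [cite: MochizukiSemiAnbd2006, Thm 3.7(iii) p.41] -/
theorem mem_of_adjacent_translates (hVD : VerticialDistinct.{u}) (h𝒢 : 𝒢.Thm37Hypotheses)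
    {v : 𝒢.graph.Vertex} {H : Subgroup c.G} (hH : H ∈ verticialSubgroups c v)
    (y : ∀ j, (D.tree j).Vertex) (hyc : ∀ ⦃i j : D.J⦄ (h : i ≤ j), (D.trans h).vertexMap (y j) = y i)
    (hyH : ∀ h ∈ H, ∀ j, (D.act j h).hom.vertexMap (y j) = y j) (g : c.G)
    (hadj₁ : ∀ j, (D.act j g).hom.vertexMap (y j) ≠ y j →
      ∃ (e : (D.tree j).Edge) (b b' : (D.tree j).Branch), (D.tree j).edgeOf b = e ∧
        (D.tree j).edgeOf b' = e ∧ (D.tree j).abuts b = some (y j) ∧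
        (D.tree j).abuts b' = some ((D.act j g).hom.vertexMap (y j)))
    (hadj₂ : ∀ j, (D.act j g).hom.vertexMap ((D.act j g).hom.vertexMap (y j)) ≠ y j →
      ∃ (e : (D.tree j).Edge) (b b' : (D.tree j).Branch), (D.tree j).edgeOf b = e ∧
        (D.tree j).edgeOf b' = e ∧ (D.tree j).abuts b = some (y j) ∧
        (D.tree j).abuts b' = some ((D.act j g).hom.vertexMap ((D.act j g).hom.vertexMap (y j)))) :
    g ∈ H := by
  classical
  -- (I2) with Thm 3.7 (ii): `H` is the full stabiliser of `y`
  obtain ⟨v', H', hH', hstab⟩ := D.stab y hyc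
  have hHH' : H = H' :=
    eq_of_le_of_mem_verticialSubgroups hVD h𝒢 c hH hH' fun h hh => hstab h (hyH h hh)
  by_cases hgy : ∀ j, (D.act j g).hom.vertexMap (y j) = y j
  · rw [hHH']
    exact hstab g hgy
  exfalso
  obtain ⟨i, hi⟩ := not_forall.mp hgy
  -- the edge `ε : y i — g·y i`
  obtain ⟨ε, β, β', hβε, hβ'ε, hβy, hβ'y'⟩ := hadj₁ i hi
  -- `g·ε ≠ ε`: otherwise `g` fixes the branch `β`, hence `y i`
  have hgε : (D.act i g).hom.edgeMap ε ≠ ε := by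
    intro h
    have hb : (D.act i g).hom.branchMap β = β :=
      D.branchMap_eq_of_edgeMap_eq i g β (by rw [hβε]; exact h)
    have hab := (D.act i g).hom.abuts_branchMap β (y i) hβy
    rw [hb, hβy] at hab
    exact hi (Option.some_injective _ hab).symm
  -- the branches of `g·ε`: `g·β` at `g·y i`, `g·β'` at `g²·y i`
  have hgβε : (D.tree i).edgeOf ((D.act i g).hom.branchMap β) = (D.act i g).hom.edgeMap ε := by
    rw [(D.act i g).hom.edgeOf_branchMap, hβε]
  have hgβ'ε : (D.tree i).edgeOf ((D.act i g).hom.branchMap β') = (D.act i g).hom.edgeMap ε := by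
    rw [(D.act i g).hom.edgeOf_branchMap, hβ'ε]
  have hgβy' : (D.tree i).abuts ((D.act i g).hom.branchMap β) =
      some ((D.act i g).hom.vertexMap (y i)) :=
    (D.act i g).hom.abuts_branchMap β (y i) hβy
  have hgβ'y'' : (D.tree i).abuts ((D.act i g).hom.branchMap β') =
      some ((D.act i g).hom.vertexMap ((D.act i g).hom.vertexMap (y i))) :=
    (D.act i g).hom.abuts_branchMap β' _ hβ'y'
  by_cases heq : (D.act i g).hom.vertexMap ((D.act i g).hom.vertexMap (y i)) = y i
  · -- double edge between `y i` and `g·y i`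
    refine hgε (SemiGraph.edge_unique_of_abuts (D.isTree i) (Ne.symm hi) hβε hβ'ε hgβ'ε hgβε hβy hβ'y'
      ?_ hgβy').symm
    rw [hgβ'y'', heq]
  · -- triangle `y i, g·y i, g²·y i`
    have hne₂ : (D.act i g).hom.vertexMap (y i) ≠
        (D.act i g).hom.vertexMap ((D.act i g).hom.vertexMap (y i)) :=
      fun h => hi (D.act_vertexMap_injective' i g h).symm
    obtain ⟨ε₃, β₃, β₃', hβ₃ε, hβ₃'ε, hβ₃y, hβ₃'y''⟩ := hadj₂ i heq
    exact SemiGraph.not_three_pairwise_joined (D.isTree i) (Ne.symm hi) hne₂ (Ne.symm heq) hβε hβ'ε hβy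
      hβ'y' hgβε hgβ'ε hgβy' hgβ'y'' hβ₃ε hβ₃'ε hβ₃y hβ₃'y''

/-! ### `g ∈ H` from BOUNDED DISPLACEMENT, given adjacency of bounded-distance fixed pairs -/

/-- **A centralising element of bounded displacement lies in the verticial host**, over any level data `D`
for which compatible `C`-fixed vertex systems at BOUNDED subdivision distance are adjacent where they differ
(`hadjbd`; hypothesis-free at the canonical tower of every countable `𝒢`, abc-iut-L3-t10's
`hadj_temperedPiChart_of_bounded_dist'`): for `H ⊇ C` verticial with a compatible `H`-fixed vertex system
`y` and `g` commuting with `C`, if `dist(yⱼ, g·yⱼ)` is bounded then `g ∈ H` — `g·y`, `g²·y` are compatible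
and `C`-fixed, `dist(yⱼ, g²·yⱼ) ≤ 2·dist(yⱼ, g·yⱼ)` by the isometry `SemiGraph.subdivision_dist_nodeMap`,
and `mem_of_adjacent_translates` concludes. [cite: MochizukiSemiAnbd2006, Thm 3.7(iii) p.41] -/
theorem mem_of_centralizer_of_bounded_displacement (hVD : VerticialDistinct.{u}) (h𝒢 : 𝒢.Thm37Hypotheses)
    (C : Subgroup c.G)
    (hadjbd : ∀ x x' : ∀ j, (D.tree j).Vertex,
      (∀ ⦃i j : D.J⦄ (h : i ≤ j), (D.trans h).vertexMap (x j) = x i) →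
      (∀ ⦃i j : D.J⦄ (h : i ≤ j), (D.trans h).vertexMap (x' j) = x' i) →
      (∀ k ∈ C, ∀ j, (D.act j k).hom.vertexMap (x j) = x j) →
      (∀ k ∈ C, ∀ j, (D.act j k).hom.vertexMap (x' j) = x' j) →
      (∃ N : ℕ, ∀ j, (D.tree j).subdivision.dist (Sum.inl (x j)) (Sum.inl (x' j)) ≤ N) →
      ∀ j, x j ≠ x' j → ∃ (e : (D.tree j).Edge) (b b' : (D.tree j).Branch), b ≠ b' ∧
        (D.tree j).edgeOf b = e ∧ (D.tree j).edgeOf b' = e ∧ (D.tree j).abuts b = some (x j) ∧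
        (D.tree j).abuts b' = some (x' j) ∧ ∀ k ∈ C, (D.act j k).hom.edgeMap e = e)
    {v : 𝒢.graph.Vertex} {H : Subgroup c.G} (hH : H ∈ verticialSubgroups c v) (hCH : C ≤ H)
    (y : ∀ j, (D.tree j).Vertex) (hyc : ∀ ⦃i j : D.J⦄ (h : i ≤ j), (D.trans h).vertexMap (y j) = y i)
    (hyH : ∀ h ∈ H, ∀ j, (D.act j h).hom.vertexMap (y j) = y j) (g : c.G)
    (hg : g ∈ Subgroup.centralizer (C : Set c.G))
    (hbd : ∃ N : ℕ, ∀ j,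
      (D.tree j).subdivision.dist (Sum.inl (y j)) (Sum.inl ((D.act j g).hom.vertexMap (y j))) ≤ N) :
    g ∈ H := by
  have hcomm : ∀ k ∈ C, k * g = g * k := fun k hk => Subgroup.mem_centralizer_iff.mp hg k hk
  have hyC : ∀ k ∈ C, ∀ j, (D.act j k).hom.vertexMap (y j) = y j := fun k hk j => hyH k (hCH hk) j
  -- the translates `g·y`, `g²·y`: compatible and `C`-fixed
  have hy₁c := D.translate_compat' g hyc
  have hy₁C := D.translate_fixed' hcomm hyC
  have hy₂c := D.translate_compat' g hy₁c
  have hy₂C := D.translate_fixed' hcomm hy₁C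
  -- displacement of `g²` along `y` is at most twice that of `g`
  obtain ⟨N, hN⟩ := hbd
  have hbd₂ : ∃ N' : ℕ, ∀ j, (D.tree j).subdivision.dist (Sum.inl (y j))
      (Sum.inl ((D.act j g).hom.vertexMap ((D.act j g).hom.vertexMap (y j)))) ≤ N' := by
    refine ⟨N + N, fun j => ?_⟩
    have hconn : (D.tree j).IsConnected := ⟨(D.isTree j).isTree.1⟩
    have hiso := SemiGraph.subdivision_dist_nodeMap hconn (D.act j g) (Sum.inl (y j))
      (Sum.inl ((D.act j g).hom.vertexMap (y j)))
    have h2 : (D.tree j).subdivision.dist (Sum.inl ((D.act j g).hom.vertexMap (y j)))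
        (Sum.inl ((D.act j g).hom.vertexMap ((D.act j g).hom.vertexMap (y j)))) ≤ N := by
      have h1 := hN j
      rw [← hiso] at h1
      exact h1
    have htri := (D.isTree j).isTree.1.dist_triangle (u := (Sum.inl (y j) : (D.tree j).Node))
      (v := Sum.inl ((D.act j g).hom.vertexMap (y j)))
      (w := Sum.inl ((D.act j g).hom.vertexMap ((D.act j g).hom.vertexMap (y j))))
    have h1 := hN j
    omega
  -- adjacency of both pairs where they differ
  refine D.mem_of_adjacent_translates hVD h𝒢 hH y hyc hyH g ?_ ?_
  · intro j hne
    obtain ⟨e, b, b', -, hbe, hb'e, hb, hb', -⟩ :=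
      hadjbd y (fun j => (D.act j g).hom.vertexMap (y j)) hyc hy₁c hyC hy₁C ⟨N, hN⟩ j (Ne.symm hne)
    exact ⟨e, b, b', hbe, hb'e, hb, hb'⟩
  · intro j hne
    obtain ⟨e, b, b', -, hbe, hb'e, hb, hb', -⟩ :=
      hadjbd y (fun j => (D.act j g).hom.vertexMap ((D.act j g).hom.vertexMap (y j))) hyc hy₂c hyC hy₂C
        hbd₂ j (Ne.symm hne)
    exact ⟨e, b, b', hbe, hb'e, hb, hb'⟩

end VerticialLevelData

/-! ### The escape dichotomy at the canonical tower of an arbitrary countable `𝒢` -/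

variable (𝒢 : ProfiniteSemiGraph.{u}) {ℋ : ProfiniteSemiGraph.{u}}

/-- **A centralising element of bounded displacement lies in the verticial host — EVERY countable `𝒢`**
satisfying the hypotheses of [SemiAnbd] Thm 3.7 (no finiteness, no (FIX∞)), at the canonical tower
`verticialLevelData_temperedPiChart` of Prop. 3.6: let `C ≠ 1` be compact, `H ⊇ C` verticial, `y` a compatible
vertex system of the trees `𝔾̃ₙ` fixed by `H`, and `g` centralise `C`.  If the subdivision distance
`dist(yⱼ, g·yⱼ)` is bounded in `j`, then `g ∈ H` (`VerticialLevelData.mem_of_centralizer_of_bounded_displacement`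
fed by abc-iut-L3-t10's hypothesis-free `hadj_temperedPiChart_of_bounded_dist'`).
[cite: MochizukiSemiAnbd2006, Thm 3.7(iii) pp.40-41] -/
theorem mem_verticial_of_centralizer_of_bounded_displacement (h37 : 𝒢.Thm37Hypotheses)
    (C : Subgroup (𝒢.temperedPiChart h37.toProp36Hypotheses).G)
    (hCc : IsCompact (C : Set (𝒢.temperedPiChart h37.toProp36Hypotheses).G)) (hC : C ≠ ⊥)
    {v : 𝒢.graph.Vertex} {H : Subgroup (𝒢.temperedPiChart h37.toProp36Hypotheses).G}
    (hH : H ∈ verticialSubgroups (𝒢.temperedPiChart h37.toProp36Hypotheses) v) (hCH : C ≤ H)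
    (y : ∀ j, ((verticialLevelData_temperedPiChart (h36 := h37.toProp36Hypotheses)).tree j).Vertex)
    (hyc : ∀ ⦃i j : ℕ⦄ (hij : i ≤ j),
      ((verticialLevelData_temperedPiChart (h36 := h37.toProp36Hypotheses)).trans hij).vertexMap (y j) = y i)
    (hyH : ∀ h ∈ H, ∀ j,
      ((verticialLevelData_temperedPiChart (h36 := h37.toProp36Hypotheses)).act j h).hom.vertexMap (y j) = y j)
    (g : (𝒢.temperedPiChart h37.toProp36Hypotheses).G)
    (hg : g ∈ Subgroup.centralizer (C : Set (𝒢.temperedPiChart h37.toProp36Hypotheses).G))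
    (hbd : ∃ N : ℕ, ∀ j,
      ((verticialLevelData_temperedPiChart (h36 := h37.toProp36Hypotheses)).tree j).subdivision.dist
        (Sum.inl (y j))
        (Sum.inl (((verticialLevelData_temperedPiChart (h36 := h37.toProp36Hypotheses)).act j g).hom.vertexMap
          (y j))) ≤ N) :
    g ∈ H :=
  (verticialLevelData_temperedPiChart (h36 := h37.toProp36Hypotheses)).mem_of_centralizer_of_bounded_displacement
    verticialDistinct_holds h37 C
    (fun x x' hx hx' hfx hfx' hb j hne => hadj_temperedPiChart_of_bounded_dist' h37 C hCc hC x x' hx hx' hfx hfx'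
      hb j hne)
    hH hCH y hyc hyH g hg hbd

/-- **ESCAPE DICHOTOMY for centralising elements — every countable `𝒢`** ([SemiAnbd] Thm 3.7 (iii) p. 41,
Cor. 3.9 p. 43): with `C`, `H`, `y` as above, an element `g` centralising `C` either lies in `H` or ESCAPES along
`y`: its displacement `dist(yⱼ, g·yⱼ)` is unbounded. [cite: MochizukiSemiAnbd2006, Thm 3.7(iii) pp.40-41] -/
theorem centralizer_dichotomy (h37 : 𝒢.Thm37Hypotheses)
    (C : Subgroup (𝒢.temperedPiChart h37.toProp36Hypotheses).G)
    (hCc : IsCompact (C : Set (𝒢.temperedPiChart h37.toProp36Hypotheses).G)) (hC : C ≠ ⊥)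
    {v : 𝒢.graph.Vertex} {H : Subgroup (𝒢.temperedPiChart h37.toProp36Hypotheses).G}
    (hH : H ∈ verticialSubgroups (𝒢.temperedPiChart h37.toProp36Hypotheses) v) (hCH : C ≤ H)
    (y : ∀ j, ((verticialLevelData_temperedPiChart (h36 := h37.toProp36Hypotheses)).tree j).Vertex)
    (hyc : ∀ ⦃i j : ℕ⦄ (hij : i ≤ j),
      ((verticialLevelData_temperedPiChart (h36 := h37.toProp36Hypotheses)).trans hij).vertexMap (y j) = y i)
    (hyH : ∀ h ∈ H, ∀ j,
      ((verticialLevelData_temperedPiChart (h36 := h37.toProp36Hypotheses)).act j h).hom.vertexMap (y j) = y j)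
    (g : (𝒢.temperedPiChart h37.toProp36Hypotheses).G)
    (hg : g ∈ Subgroup.centralizer (C : Set (𝒢.temperedPiChart h37.toProp36Hypotheses).G)) :
    g ∈ H ∨ ∀ N : ℕ, ∃ j,
      N < ((verticialLevelData_temperedPiChart (h36 := h37.toProp36Hypotheses)).tree j).subdivision.dist
        (Sum.inl (y j))
        (Sum.inl (((verticialLevelData_temperedPiChart (h36 := h37.toProp36Hypotheses)).act j g).hom.vertexMap
          (y j))) := by
  by_cases hbd : ∃ N : ℕ, ∀ j,
      ((verticialLevelData_temperedPiChart (h36 := h37.toProp36Hypotheses)).tree j).subdivision.dist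
        (Sum.inl (y j))
        (Sum.inl (((verticialLevelData_temperedPiChart (h36 := h37.toProp36Hypotheses)).act j g).hom.vertexMap
          (y j))) ≤ N
  · exact Or.inl (𝒢.mem_verticial_of_centralizer_of_bounded_displacement h37 C hCc hC hH hCH y hyc hyH g hg hbd)
  · refine Or.inr fun N => ?_
    by_contra hall
    push Not at hall
    exact hbd ⟨N, hall⟩

/-- **Every verticial subgroup fixes a compatible vertex system of the canonical tower** — (I1) of the
canonical level data, exposed for the consumers of the dichotomy. [cite: MochizukiSemiAnbd2006, Thm 3.7(iii) p.41] -/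
theorem exists_fixed_system_of_mem_verticialSubgroups (h37 : 𝒢.Thm37Hypotheses) {v : 𝒢.graph.Vertex}
    {H : Subgroup (𝒢.temperedPiChart h37.toProp36Hypotheses).G}
    (hH : H ∈ verticialSubgroups (𝒢.temperedPiChart h37.toProp36Hypotheses) v) :
    ∃ y : ∀ j, ((verticialLevelData_temperedPiChart (h36 := h37.toProp36Hypotheses)).tree j).Vertex,
      (∀ ⦃i j : ℕ⦄ (hij : i ≤ j),
        ((verticialLevelData_temperedPiChart (h36 := h37.toProp36Hypotheses)).trans hij).vertexMap (y j) = y i) ∧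
      ∀ h ∈ H, ∀ j,
        ((verticialLevelData_temperedPiChart (h36 := h37.toProp36Hypotheses)).act j h).hom.vertexMap (y j) = y j :=
  (verticialLevelData_temperedPiChart (h36 := h37.toProp36Hypotheses)).fix v H hH

/-! ### F-2773 re-bound to «no escaping centralising element» -/

/-- **F-2773 `EdgeLikeCentralizer` from BOUNDED DISPLACEMENT of centralising elements alone**: if at every
graph of anabelioids `ℋ` satisfying the hypotheses of Thm 3.7, for every compact `C ≠ 1` of the canonical
`π₁^temp(ℋ)`, every verticial `H ⊇ C` with a compatible `H`-fixed vertex system `y` of the canonical tower, and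
every `g` centralising `C`, the displacement `dist(yⱼ, g·yⱼ)` is bounded, then `EdgeLikeCentralizer` (every
chart, by transport along `TemperedPiChart.exists_compatIso`).  A theorem at locally finite `𝔾`
(`edgeLikeCentralizer_of_isLocallyFinite`); the binder is open only at vertices of infinite valence.
[cite: MochizukiSemiAnbd2006, Cor 3.9 p.43] -/
theorem edgeLikeCentralizer_of_bounded_displacement
    (Hbd : ∀ (ℋ : ProfiniteSemiGraph.{u}) (h37 : ℋ.Thm37Hypotheses)
      (C : Subgroup (ℋ.temperedPiChart h37.toProp36Hypotheses).G),
      IsCompact (C : Set (ℋ.temperedPiChart h37.toProp36Hypotheses).G) → C ≠ ⊥ →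
      ∀ (v : ℋ.graph.Vertex) (H : Subgroup (ℋ.temperedPiChart h37.toProp36Hypotheses).G),
      H ∈ verticialSubgroups (ℋ.temperedPiChart h37.toProp36Hypotheses) v → C ≤ H →
      ∀ y : ∀ j, ((verticialLevelData_temperedPiChart (h36 := h37.toProp36Hypotheses)).tree j).Vertex,
      (∀ ⦃i j : ℕ⦄ (hij : i ≤ j),
        ((verticialLevelData_temperedPiChart (h36 := h37.toProp36Hypotheses)).trans hij).vertexMap (y j) = y i) →
      (∀ h ∈ H, ∀ j,
        ((verticialLevelData_temperedPiChart (h36 := h37.toProp36Hypotheses)).act j h).hom.vertexMap (y j) = y j) →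
      ∀ g ∈ Subgroup.centralizer (C : Set (ℋ.temperedPiChart h37.toProp36Hypotheses).G), ∃ N : ℕ, ∀ j,
        ((verticialLevelData_temperedPiChart (h36 := h37.toProp36Hypotheses)).tree j).subdivision.dist
          (Sum.inl (y j))
          (Sum.inl (((verticialLevelData_temperedPiChart (h36 := h37.toProp36Hypotheses)).act j g).hom.vertexMap
            (y j))) ≤ N) :
    Literature.AnabelianGeometry.SemiGraphs.ProfiniteSemiGraph.EdgeLikeCentralizer.{u} := by
  intro ℋ hℋ c e ψ hψ U hU v H hH hUH
  have h37 : ℋ.Thm37Hypotheses := hℋ.thm37Hypotheses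
  obtain ⟨hCc, hC⟩ := isCompact_map_and_ne_bot_of_isEdgeHom hℋ c e ψ hψ U hU
  -- compatible isomorphism between the canonical chart `c₀` and `c`
  obtain ⟨φ, ψ', hψφ, hφψ, hφ, hψ'⟩ :=
    TemperedPiChart.exists_compatIso (ℋ.temperedPiChart h37.toProp36Hypotheses) c
  have hinj : Function.Injective ψ' := fun y₁ y₂ h => by rw [← hφψ y₁, ← hφψ y₂, h]
  -- move `ψ(U) ≤ H` to the canonical chart
  have hC₀c : IsCompact (((U.map ψ.toMonoidHom).map ψ'.toMonoidHom :
      Subgroup (ℋ.temperedPiChart h37.toProp36Hypotheses).G) :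
        Set (ℋ.temperedPiChart h37.toProp36Hypotheses).G) := by
    rw [Subgroup.coe_map]
    exact hCc.image ψ'.continuous
  have hC₀ : (U.map ψ.toMonoidHom).map ψ'.toMonoidHom ≠ ⊥ := fun h0 =>
    hC ((Subgroup.map_eq_bot_iff_of_injective (U.map ψ.toMonoidHom) hinj).mp h0)
  have hH₀ : H.map ψ'.toMonoidHom ∈ verticialSubgroups (ℋ.temperedPiChart h37.toProp36Hypotheses) v :=
    (mem_verticialSubgroups_iff_map φ hφ ψ' hφψ hψ' H).mp hH
  have hCH₀ : (U.map ψ.toMonoidHom).map ψ'.toMonoidHom ≤ H.map ψ'.toMonoidHom := Subgroup.map_mono hUH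
  obtain ⟨y, hyc, hyH⟩ := ℋ.exists_fixed_system_of_mem_verticialSubgroups h37 hH₀
  intro g hg
  -- `ψ' g` centralises the image of `ψ(U)`
  have hg₀ : ψ' g ∈ Subgroup.centralizer ((((U.map ψ.toMonoidHom).map ψ'.toMonoidHom :
      Subgroup (ℋ.temperedPiChart h37.toProp36Hypotheses).G)) :
        Set (ℋ.temperedPiChart h37.toProp36Hypotheses).G) := by
    refine Subgroup.mem_centralizer_iff.mpr ?_
    rintro _ ⟨k, hk, rfl⟩
    have hkg : k * g = g * k := Subgroup.mem_centralizer_iff.mp hg k hk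
    change ψ' k * ψ' g = ψ' g * ψ' k
    rw [← map_mul, ← map_mul, hkg]
  have hmem : ψ' g ∈ H.map ψ'.toMonoidHom :=
    ℋ.mem_verticial_of_centralizer_of_bounded_displacement h37 _ hC₀c hC₀ hH₀ hCH₀ y hyc hyH (ψ' g) hg₀
      (Hbd ℋ h37 _ hC₀c hC₀ v _ hH₀ hCH₀ y hyc hyH (ψ' g) hg₀)
  obtain ⟨h, hh, hhg⟩ := hmem
  have hhg' : h = g := hinj hhg
  exact hhg' ▸ hh

end ProfiniteSemiGraph

end Literature.AnabelianGeometry.SemiGraphs
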